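import Mathlib.Analysis.Normed.Operator.Bilinear
import HarnessLib

/-!
# Gap below the trivial zero of a quadratic map (the small-amplitude exclusion ball of the Z2/Z7 Leray-certificate search)

Summits/NavierStokesRegularity support file for item stmt-NavierStokesRegularity-0155 (`DssFarFieldSlaving.BlowupTypeIDssProfile`,
the certificate endpoint of the profile-search zones Z2/Z7; everything proved; no definitions, no named facts; pure functional
analysis — nothing here is a statement about Navier–Stokes).  For a map of the form
`F x = J x + B x x` with `J : X →L Y` linear, `B : X →L X →L Y` bilinear and `A : Y →L X` a LEFT inverse of `J`
(`A (J x) = x`), every zero satisfies `x = -A (B x x)`, hence `‖x‖ ≤ K ‖x‖²` as soon as `‖A (B u u)‖ ≤ K ‖u‖²`; so the zero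
set meets the open ball `‖x‖ < 1/K` only in `x = 0`.  This is the structural half of the «small-amplitude exclusion ball»
certificate for quadratic (Galerkin-truncated, Navier–Stokes-type) maps: the float / interval work is the bound `K`
(two implementations); the conclusion is this file.  Companion of `Literature/Analysis/Calculus/RadiiPolynomial.lean`
(inclusion) and `Literature/Analysis/Calculus/RadiiPolynomialExclusion.lean` (Krawczyk exclusion around a non-zero
approximate root, p449679).

* `norm_le_mul_norm_sq_of_quadratic_zero` — `J x + B x x = 0` ⇒ `‖x‖ ≤ K ‖x‖²` under the pointwise bound on `A (B u u)`.
* `eq_zero_or_inv_le_norm_of_quadratic_zero` — a zero is `0` or has `‖x‖ ≥ 1/K` (`K > 0`).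
* `eq_zero_of_quadratic_zero_of_norm_lt` — a zero with `K ‖x‖ < 1` is `0`.
* `norm_le_opNorm_mul_norm_sq_of_quadratic_zero` — the operator-norm form `‖x‖ ≤ ‖A‖ ‖B‖ ‖x‖²`.

USE (cell ns-blowup, profile zones Z2/Z7; honest framing there: the map is a TRUNCATED discretised Leray system, the ball is a
statement about that truncated map in its coefficient norm, never about Navier–Stokes): RULING (bh)(3) item (b).

## References

* L. V. Kantorovich, G. P. Akilov, *Functional Analysis* (2nd ed., Pergamon 1982), Ch. XVIII §1 (Newton's method; the
  quadratic estimate). [folklore]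
-/

noncomputable section

set_option linter.dupNamespace false

namespace Summit.NavierStokesRegularity.NavierStokesRegularity.Theorems.QuadraticZeroGap

variable {X : Type*} [NormedAddCommGroup X] [NormedSpace ℝ X]
  {Y : Type*} [NormedAddCommGroup Y] [NormedSpace ℝ Y]

/-- **A zero of `J x + B x x` is a fixed point of `x ↦ -A (B x x)`** when `A` is a left inverse of `J`. [folklore] -/
theorem eq_neg_apply_of_quadratic_zero (J : X →L[ℝ] Y) (B : X →L[ℝ] X →L[ℝ] Y) (A : Y →L[ℝ] X)
    (hA : ∀ x, A (J x) = x) {x : X} (hx : J x + B x x = 0) : x = -A (B x x) := by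
  have h1 : A (J x + B x x) = 0 := by rw [hx, map_zero]
  rw [map_add, hA] at h1
  exact eq_neg_of_add_eq_zero_left h1

/-- **Quadratic gap estimate.** If `A` is a left inverse of `J`, `‖A (B u u)‖ ≤ K ‖u‖²` for all `u`, and
`J x + B x x = 0`, then `‖x‖ ≤ K ‖x‖²`. [folklore] -/
theorem norm_le_mul_norm_sq_of_quadratic_zero (J : X →L[ℝ] Y) (B : X →L[ℝ] X →L[ℝ] Y) (A : Y →L[ℝ] X)
    (hA : ∀ x, A (J x) = x) {K : ℝ} (hK : ∀ u : X, ‖A (B u u)‖ ≤ K * ‖u‖ ^ 2) {x : X}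
    (hx : J x + B x x = 0) : ‖x‖ ≤ K * ‖x‖ ^ 2 := by
  have h := eq_neg_apply_of_quadratic_zero J B A hA hx
  calc ‖x‖ = ‖-A (B x x)‖ := by rw [← h]
    _ = ‖A (B x x)‖ := norm_neg _
    _ ≤ K * ‖x‖ ^ 2 := hK x

/-- **The zero set has a gap below the trivial zero**: under the hypotheses of
`norm_le_mul_norm_sq_of_quadratic_zero` with `K > 0`, a zero is either `0` or has `‖x‖ ≥ 1/K`. [folklore] -/
theorem eq_zero_or_inv_le_norm_of_quadratic_zero (J : X →L[ℝ] Y) (B : X →L[ℝ] X →L[ℝ] Y) (A : Y →L[ℝ] X)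
    (hA : ∀ x, A (J x) = x) {K : ℝ} (hKpos : 0 < K) (hK : ∀ u : X, ‖A (B u u)‖ ≤ K * ‖u‖ ^ 2) {x : X}
    (hx : J x + B x x = 0) : x = 0 ∨ 1 / K ≤ ‖x‖ := by
  by_cases h0 : x = 0
  · exact Or.inl h0
  · right
    have hxpos : 0 < ‖x‖ := norm_pos_iff.2 h0
    have h := norm_le_mul_norm_sq_of_quadratic_zero J B A hA hK hx
    have h2 : 1 ≤ K * ‖x‖ := by
      have h3 : ‖x‖ * 1 ≤ ‖x‖ * (K * ‖x‖) := by nlinarith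
      exact le_of_mul_le_mul_left h3 hxpos
    rw [div_le_iff₀ hKpos]
    linarith [mul_comm K ‖x‖]

/-- **Small-amplitude exclusion**: a zero of `J x + B x x` with `K ‖x‖ < 1` is the trivial zero. [folklore] -/
theorem eq_zero_of_quadratic_zero_of_norm_lt (J : X →L[ℝ] Y) (B : X →L[ℝ] X →L[ℝ] Y) (A : Y →L[ℝ] X)
    (hA : ∀ x, A (J x) = x) {K : ℝ} (hK : ∀ u : X, ‖A (B u u)‖ ≤ K * ‖u‖ ^ 2) {x : X}
    (hx : J x + B x x = 0) (hsmall : K * ‖x‖ < 1) : x = 0 := by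
  by_contra h0
  have hxpos : 0 < ‖x‖ := norm_pos_iff.2 h0
  have h := norm_le_mul_norm_sq_of_quadratic_zero J B A hA hK hx
  have h2 : ‖x‖ * 1 ≤ ‖x‖ * (K * ‖x‖) := by nlinarith
  have h3 : 1 ≤ K * ‖x‖ := le_of_mul_le_mul_left h2 hxpos
  linarith

/-- **Operator-norm form**: with `A` a left inverse of `J`, every zero of `J x + B x x` satisfies
`‖x‖ ≤ ‖A‖ ‖B‖ ‖x‖²` (so the gap is `1/(‖A‖ ‖B‖)`). [folklore] -/
theorem norm_le_opNorm_mul_norm_sq_of_quadratic_zero (J : X →L[ℝ] Y) (B : X →L[ℝ] X →L[ℝ] Y) (A : Y →L[ℝ] X)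
    (hA : ∀ x, A (J x) = x) {x : X} (hx : J x + B x x = 0) : ‖x‖ ≤ ‖A‖ * ‖B‖ * ‖x‖ ^ 2 := by
  refine norm_le_mul_norm_sq_of_quadratic_zero J B A hA (fun u => ?_) hx
  calc ‖A (B u u)‖ ≤ ‖A‖ * ‖B u u‖ := A.le_opNorm _
    _ ≤ ‖A‖ * (‖B‖ * ‖u‖ * ‖u‖) := by
        gcongr
        exact (B u).le_opNorm u |>.trans (by gcongr; exact B.le_opNorm u)
    _ = ‖A‖ * ‖B‖ * ‖u‖ ^ 2 := by ring

/-- **Coercive form (no inverse needed).** If `J` is bounded below, `c ‖v‖ ≤ ‖J v‖`, and the quadratic term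
satisfies `‖B u u‖ ≤ K ‖u‖²`, then every zero of `J x + B x x` satisfies `c ‖x‖ ≤ K ‖x‖²`.  This is the form a
certificate uses when `‖J v‖` is bounded below by a spectral-gap / coercivity estimate (e.g. a weighted norm in
which the linearised operator is accretive) rather than by constructing an approximate inverse. [folklore] -/
theorem mul_norm_le_mul_norm_sq_of_quadratic_zero_of_lower_bound (J : X →L[ℝ] Y) (B : X →L[ℝ] X →L[ℝ] Y)
    {c K : ℝ} (hc : ∀ v : X, c * ‖v‖ ≤ ‖J v‖) (hK : ∀ u : X, ‖B u u‖ ≤ K * ‖u‖ ^ 2) {x : X}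
    (hx : J x + B x x = 0) : c * ‖x‖ ≤ K * ‖x‖ ^ 2 := by
  have h1 : J x = -(B x x) := eq_neg_of_add_eq_zero_left hx
  calc c * ‖x‖ ≤ ‖J x‖ := hc x
    _ = ‖B x x‖ := by rw [h1, norm_neg]
    _ ≤ K * ‖x‖ ^ 2 := hK x

/-- **Gap below the trivial zero, coercive form**: under the hypotheses of
`mul_norm_le_mul_norm_sq_of_quadratic_zero_of_lower_bound` with `0 < K`, a zero of `J x + B x x` is
either `0` or has `‖x‖ ≥ c / K` (informative when `c > 0`). [folklore] -/
theorem eq_zero_or_div_le_norm_of_quadratic_zero_of_lower_bound (J : X →L[ℝ] Y) (B : X →L[ℝ] X →L[ℝ] Y)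
    {c K : ℝ} (hKpos : 0 < K) (hc : ∀ v : X, c * ‖v‖ ≤ ‖J v‖)
    (hK : ∀ u : X, ‖B u u‖ ≤ K * ‖u‖ ^ 2) {x : X} (hx : J x + B x x = 0) : x = 0 ∨ c / K ≤ ‖x‖ := by
  by_cases h0 : x = 0
  · exact Or.inl h0
  · right
    have hxpos : 0 < ‖x‖ := norm_pos_iff.2 h0
    have h := mul_norm_le_mul_norm_sq_of_quadratic_zero_of_lower_bound J B hc hK hx
    have h2 : ‖x‖ * c ≤ ‖x‖ * (K * ‖x‖) := by nlinarith
    have h3 : c ≤ K * ‖x‖ := le_of_mul_le_mul_left h2 hxpos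
    rw [div_le_iff₀ hKpos]
    linarith [mul_comm K ‖x‖]

/-- **Small-amplitude exclusion, coercive form**: a zero with `K ‖x‖ < c` is the trivial zero (`0 < K`). [folklore] -/
theorem eq_zero_of_quadratic_zero_of_lower_bound_of_norm_lt (J : X →L[ℝ] Y) (B : X →L[ℝ] X →L[ℝ] Y)
    {c K : ℝ} (hKpos : 0 < K) (hc : ∀ v : X, c * ‖v‖ ≤ ‖J v‖)
    (hK : ∀ u : X, ‖B u u‖ ≤ K * ‖u‖ ^ 2) {x : X} (hx : J x + B x x = 0) (hsmall : K * ‖x‖ < c) :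
    x = 0 := by
  rcases eq_zero_or_div_le_norm_of_quadratic_zero_of_lower_bound J B hKpos hc hK hx with h | h
  · exact h
  · exfalso
    rw [div_le_iff₀ hKpos] at h
    linarith [mul_comm K ‖x‖]

end Summit.NavierStokesRegularity.NavierStokesRegularity.Theorems.QuadraticZeroGap

end
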